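import Summits.QuantumFields.YangMills.Theorems.UnitScaleTiltProp7LineAvgRightInverse
import HarnessLib

/-!
# Route `UnitScaleTilt`, crux K1 child «MinimiserStabilityRegPr» (stmt-QuantumFields-19200), registered stub `stub_prop7From14` (skeleton birth_v6
# 636b1fa3b005; leaf V3 «Prop 7 from a background (14)») — THE TENT FIELD IS THE TRANSPOSE OF THE STRAIGHT-LINE BLOCK AVERAGE `M_k`:
# `Σ_b (M_k^⊤μ)(b)·Y(b) = Σ_c μ(c)·(M_kY)(c)`, AND THE MULTIPLIER BOUND `max|μ| ≤ L^{kd}·max|M_k^⊤μ|`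

Cell `ym3-torus` ∕ fleet seat `ym-ust-19200-p1` (gen 4).  WHERE THIS SITS.  In the `ℓ²` route to the uniqueness clause of [Balaban1985Variational]
Prop. 7 at the d = 3 carrier (`Prop7UniquenessReduction`, p504929: chart inside the group (4) + strict growth at a critical configuration), the
FIRST-ORDER term of the action at an R2-critical configuration `U` is controlled through the Euler–Lagrange equation in multiplier form
([Balaban1985Variational] Sect. F (152) «D*F = Q*λ»; at the carrier: the lineage `Prop8Criticality`, p508741/p510089): the current `J = ∂A/∂Y`
is the transpose image `M_U^⊤μ` of a multiplier `μ` on the coarse bonds, so that for a secant `Y` between two points of the averaging fibre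
`⟨J, Y⟩ = ⟨μ, M_UY⟩` — of second order, because `M_UY` is (Taylor remainder of the constraint) — while print's divergence clause of (6)
(`T3PrintedRegularMinimiser.DivSmall`: `‖D*∂U‖ < ε₀L^{−3(K−n)}`) bounds `J` pointwise.  For the flat straight-line main term `M_k` of the
linearised averaging, the transpose `M_k^⊤μ` IS the tent-interpolation field `A_μ` of gen 3's `UnitScaleTiltProp7LineAvgTwoBlock`
(`A_μ(b) = (L^{kd}L^k)⁻¹((s_b+1)μ(ȳ_b) + (L^k−1−s_b)μ(ȳ_b−e_μ))`); this file proves the two facts the linear-term estimate needs.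

WHAT IS PROVED HERE (sorry-free, no definition; [folklore] finite sums).  `n = L^k`, `h : |T^{(0)}| = L^k·|T^{(k)}|` per direction.
* §1 **`sum_adjField_mul_eq`** (TRANSPOSE IDENTITY): `Σ_b A_μ(b)Y(b) = Σ_c μ(c)·(M_kY)(c)` for every fine bond field `Y`, `M_k` in the two-block form
  of `lineAvg_eq_two_blocks`; `sum_adjField_mul_eq_bondAvgIter` (the same with `M_k = LatticeFieldCalculus.bondAvgIter k` of record).
* §2 **`abs_le_pow_mul_of_adjField_abs_le`** (MULTIPLIER BOUND): `|μ(c)| ≤ L^{kd}·max_b|A_μ(b)|` (at the last axial offset of the block the tent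
  weight is the full `L^k`); with gen 3's `adjField_abs_le` (`|A_μ| ≤ L^{−kd}max|μ|`) the two sup norms are equivalent.
* §3 **`abs_sum_adjField_mul_le`**: `|Σ_b A_μ(b)Y(b)| ≤ L^{kd}·max|A_μ|·Σ_c|(M_kY)(c)|` — the linear-term estimate for the flat main term;
  `…_bondAvgIter`, `…_T3` (d = 3 carrier: `L^{3(K−n)}`).

WHAT THIS IS NOT.  Not the Euler–Lagrange equation (lineage `Prop8Criticality`), not the identification of the true linearised (0.4)-averaging with
`M_k` (it differs by the block-axial representative and comb terms, `BlockAveragingEMLLinearised`); nothing of Bałaban's is asserted.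

References: T. Bałaban, CMP 102 (1985) 277–309 [Balaban1985Variational] ((45)–(46) p.285, (152) p.300); CMP 95 (1984) 17–40 [Balaban1984PropagatorsI] ((1.18) p.20).
-/

noncomputable section

open scoped BigOperators

namespace Summit.QuantumFields.YangMills.Theorems.Prop7LineAvgAdjoint

open Literature.MathematicalPhysics.QuantumFieldTheory.Balaban1983to89
open Finset LatticeFieldCalculus B1RG242Torus
open B10StarCount (sum_pbond)
open Summit.QuantumFields.YangMills.Theorems.Prop7FlatCoercivity (iterate_shift_eq_runSite runSite_runSite runSite_apply_self
  runSite_apply_of_ne fibreSite_runSite sum_fibre_eq_sum_offsets)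
open Summit.QuantumFields.YangMills.Theorems.Prop7LineAvgRightInverse

variable {P : Params} {k : ℕ}

section Transpose

variable (h : P.sitesPerDir 0 = P.L ^ k * P.sitesPerDir k)
variable (μc : PBond P k → ℝ) (A : PBond P 0 → ℝ)
  (hA : ∀ b : PBond P 0, A b = (((P.L : ℝ) ^ k) ^ P.d * (P.L : ℝ) ^ k)⁻¹ *
    (((((b.src b.dir).val % P.L ^ k : ℕ) : ℝ) + 1) * μc ⟨Site.proj k k b.src, b.dir⟩
      + ((P.L ^ k - 1 - (b.src b.dir).val % P.L ^ k : ℕ) : ℝ) * μc ⟨(Site.proj k k b.src).unshift b.dir, b.dir⟩))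
include h hA

/-! ## §1 The transpose identity -/

/-- **THE TENT FIELD IS THE TRANSPOSE OF `M_k`**: `Σ_b A_μ(b)·Y(b) = Σ_c μ(c)·(M_kY)(c)`, `M_k` the straight-line `k`-fold block average in the
two-block form of gen 3's `lineAvg_eq_two_blocks`. [cite: Balaban1984PropagatorsI, (1.18) p.20] -/
theorem sum_adjField_mul_eq (Y : PBond P 0 → ℝ) :
    ∑ b : PBond P 0, A b * Y b
      = ∑ c : PBond P k, μc c * ((((P.L : ℝ) ^ k) ^ P.d * (P.L : ℝ) ^ k)⁻¹ *
          ∑ x ∈ univ.filter (fun x : Site P 0 => Site.proj k k x = c.src), ∑ t ∈ range (P.L ^ k), Y ⟨(fun z : Site P 0 => z.shift c.dir)^[t] x, c.dir⟩) := by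
  set C₀ : ℝ := (((P.L : ℝ) ^ k) ^ P.d * (P.L : ℝ) ^ k)⁻¹ with hC₀
  -- right-hand side in block coordinates
  have hR : ∀ c : PBond P k, μc c * (C₀ *
        ∑ x ∈ univ.filter (fun x : Site P 0 => Site.proj k k x = c.src), ∑ t ∈ range (P.L ^ k), Y ⟨(fun z : Site P 0 => z.shift c.dir)^[t] x, c.dir⟩)
      = μc c * (C₀ * ∑ r : Fin P.d → Fin (P.L ^ k), (((r c.dir : ℕ) : ℝ) + 1) * Y ⟨Site.fibreSite 0 k c.src r, c.dir⟩)
        + μc c * (C₀ * ∑ r : Fin P.d → Fin (P.L ^ k), ((P.L ^ k - 1 - (r c.dir : ℕ) : ℕ) : ℝ) * Y ⟨Site.fibreSite 0 k (runSite c.src c.dir 1) r, c.dir⟩) := by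
    intro c
    rw [lineAvg_eq_two_blocks h Y c]; ring
  rw [Finset.sum_congr rfl fun c _ => hR c, Finset.sum_add_distrib]
  -- re-index the second sum by `c ↦ c − e_μ`
  have hre : ∑ c : PBond P k, μc c * (C₀ * ∑ r : Fin P.d → Fin (P.L ^ k), ((P.L ^ k - 1 - (r c.dir : ℕ) : ℕ) : ℝ) * Y ⟨Site.fibreSite 0 k (runSite c.src c.dir 1) r, c.dir⟩)
      = ∑ c : PBond P k, μc ⟨c.src.unshift c.dir, c.dir⟩ * (C₀ * ∑ r : Fin P.d → Fin (P.L ^ k), ((P.L ^ k - 1 - (r c.dir : ℕ) : ℕ) : ℝ) * Y ⟨Site.fibreSite 0 k c.src r, c.dir⟩) := by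
    rw [← sum_pbond_runSite_one (fun c : PBond P k => μc ⟨c.src.unshift c.dir, c.dir⟩ *
      (C₀ * ∑ r : Fin P.d → Fin (P.L ^ k), ((P.L ^ k - 1 - (r c.dir : ℕ) : ℕ) : ℝ) * Y ⟨Site.fibreSite 0 k c.src r, c.dir⟩))]
    simp only [unshift_runSite_one]
  rw [hre, ← Finset.sum_add_distrib]
  -- left-hand side in block coordinates
  rw [sum_pbond_fine_eq h (fun b => A b * Y b), sum_dir_site_eq (fun c : PBond P k =>
    μc c * (C₀ * ∑ r : Fin P.d → Fin (P.L ^ k), (((r c.dir : ℕ) : ℝ) + 1) * Y ⟨Site.fibreSite 0 k c.src r, c.dir⟩)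
      + μc ⟨c.src.unshift c.dir, c.dir⟩ * (C₀ * ∑ r : Fin P.d → Fin (P.L ^ k), ((P.L ^ k - 1 - (r c.dir : ℕ) : ℕ) : ℝ) * Y ⟨Site.fibreSite 0 k c.src r, c.dir⟩)) |>.symm]
  refine Finset.sum_congr rfl fun ν _ => Finset.sum_congr rfl fun y _ => ?_
  simp only [adjField_fibreSite h μc A hA, Finset.mul_sum, ← Finset.sum_add_distrib]
  exact Finset.sum_congr rfl fun r _ => by ring

/-- The same with the straight-line block average written as the iterated linear bond average of record `bondAvgIter k`
(`Prop7FlatCoercivity.bondAvgIter_eq_lineBlockAvg_real`), `k` in the standing range. [cite: Balaban1984PropagatorsI, (1.18) p.20] -/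
theorem sum_adjField_mul_eq_bondAvgIter (hk : k ≤ P.m + P.K) (Y : VecField P 0 ℝ) :
    ∑ b : PBond P 0, A b * Y b = ∑ c : PBond P k, μc c * bondAvgIter k Y c := by
  rw [sum_adjField_mul_eq h μc A hA Y]
  exact Finset.sum_congr rfl fun c _ => by rw [Prop7FlatCoercivity.bondAvgIter_eq_lineBlockAvg_real hk]

/-! ## §2 The multiplier bound -/

/-- **MULTIPLIER BOUND**: `|μ(c)| ≤ L^{kd}·B` whenever `|A_μ| ≤ B` — at the fine bond of `B^k(c₋)` with the last axial offset `L^k − 1` the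
tent field is `(L^{kd})⁻¹·μ(c)` exactly. [folklore] -/
theorem abs_le_pow_mul_of_adjField_abs_le {B : ℝ} (hB : ∀ b : PBond P 0, |A b| ≤ B) (c : PBond P k) :
    |μc c| ≤ ((P.L : ℝ) ^ k) ^ P.d * B := by
  have hN : (0 : ℝ) < (P.L : ℝ) ^ k := pow_pos (by exact_mod_cast P.L_pos) k
  have h1 : 1 ≤ P.L ^ k := Nat.one_le_pow _ _ P.L_pos
  -- the offset with last axial coordinate
  let r : Fin P.d → Fin (P.L ^ k) := fun _ => ⟨P.L ^ k - 1, by omega⟩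
  have hval := adjField_fibreSite h μc A hA c.src c.dir r
  have hc1 : (((r c.dir : ℕ) : ℝ) + 1) = (P.L : ℝ) ^ k := by
    show (((P.L ^ k - 1 : ℕ) : ℕ) : ℝ) + 1 = (P.L : ℝ) ^ k
    rw [Nat.cast_sub h1]; push_cast; ring
  have hc2 : ((P.L ^ k - 1 - (r c.dir : ℕ) : ℕ) : ℝ) = 0 := by
    show (((P.L ^ k - 1 - (P.L ^ k - 1) : ℕ) : ℕ) : ℝ) = 0
    rw [Nat.sub_self]; push_cast; ring
  rw [hc1, hc2, zero_mul, add_zero] at hval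
  have hc : (⟨c.src, c.dir⟩ : PBond P k) = c := rfl
  rw [hc] at hval
  -- `A(b₀) = (L^{kd})⁻¹ μ(c)`
  have hval' : A ⟨Site.fibreSite 0 k c.src r, c.dir⟩ = (((P.L : ℝ) ^ k) ^ P.d)⁻¹ * μc c := by
    rw [hval]; field_simp
  have hb := hB ⟨Site.fibreSite 0 k c.src r, c.dir⟩
  rw [hval', abs_mul, abs_of_nonneg (by positivity)] at hb
  have hpos : (0 : ℝ) < ((P.L : ℝ) ^ k) ^ P.d := by positivity
  calc |μc c| = ((P.L : ℝ) ^ k) ^ P.d * ((((P.L : ℝ) ^ k) ^ P.d)⁻¹ * |μc c|) := by field_simp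
    _ ≤ ((P.L : ℝ) ^ k) ^ P.d * B := mul_le_mul_of_nonneg_left hb hpos.le

/-! ## §3 The linear-term estimate for the flat main term -/

/-- **`|Σ_b A_μ(b)Y(b)| ≤ L^{kd}·max|A_μ|·Σ_c|(M_kY)(c)|`**: a current of tent form with sup norm `≤ B` pairs with any fine field through the block
averages of that field only. [cite: Balaban1985Variational, (152) p.300] -/
theorem abs_sum_adjField_mul_le {B : ℝ} (hB : ∀ b : PBond P 0, |A b| ≤ B) (Y : PBond P 0 → ℝ) :
    |∑ b : PBond P 0, A b * Y b|
      ≤ ((P.L : ℝ) ^ k) ^ P.d * B * ∑ c : PBond P k, |(((P.L : ℝ) ^ k) ^ P.d * (P.L : ℝ) ^ k)⁻¹ *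
          ∑ x ∈ univ.filter (fun x : Site P 0 => Site.proj k k x = c.src), ∑ t ∈ range (P.L ^ k), Y ⟨(fun z : Site P 0 => z.shift c.dir)^[t] x, c.dir⟩| := by
  rw [sum_adjField_mul_eq h μc A hA Y, Finset.mul_sum]
  refine (Finset.abs_sum_le_sum_abs _ _).trans (Finset.sum_le_sum fun c _ => ?_)
  rw [abs_mul]
  exact mul_le_mul_of_nonneg_right (abs_le_pow_mul_of_adjField_abs_le h μc A hA hB c) (abs_nonneg _)

/-- The same with `M_k = bondAvgIter k` of record, `k` in the standing range. [cite: Balaban1985Variational, (152) p.300] -/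
theorem abs_sum_adjField_mul_le_bondAvgIter (hk : k ≤ P.m + P.K) {B : ℝ} (hB : ∀ b : PBond P 0, |A b| ≤ B) (Y : VecField P 0 ℝ) :
    |∑ b : PBond P 0, A b * Y b| ≤ ((P.L : ℝ) ^ k) ^ P.d * B * ∑ c : PBond P k, |bondAvgIter k Y c| := by
  have h0 := abs_sum_adjField_mul_le h μc A hA hB Y
  have he : ∀ c : PBond P k, |(((P.L : ℝ) ^ k) ^ P.d * (P.L : ℝ) ^ k)⁻¹ *
      ∑ x ∈ univ.filter (fun x : Site P 0 => Site.proj k k x = c.src), ∑ t ∈ range (P.L ^ k), Y ⟨(fun z : Site P 0 => z.shift c.dir)^[t] x, c.dir⟩|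
        = |bondAvgIter k Y c| := fun c => by rw [Prop7FlatCoercivity.bondAvgIter_eq_lineBlockAvg_real hk]
  simp only [he] at h0
  exact h0

end Transpose

/-- **AT THE d = 3 CARRIER** of `T3Thm1Carrier.varProblem3 F n K` (`k = K − n`): for a multiplier `μ` on the coarse bonds and its tent field `A_μ`
(= `M_{K−n}^⊤μ`) with `|A_μ| ≤ B`, every fine field `Y` satisfies `|Σ_b A_μ(b)Y(b)| ≤ L^{3(K−n)}·B·Σ_c|(Q_{K−n}Y)(c)|`, and `|μ(c)| ≤ L^{3(K−n)}·B`.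
With print's divergence clause `B = ε₀L^{−3(K−n)}` this is `|⟨A_μ, Y⟩| ≤ ε₀·Σ_c|(Q_{K−n}Y)(c)|`. [cite: Balaban1985Variational, (6) p.278, (152) p.300] -/
theorem abs_sum_adjField_mul_le_T3 (F : T3ContinuumYM3Torus.T3Family) (n K : ℕ) (μc : PBond (F.P K) (K - n) → ℝ) (A : PBond (F.P K) 0 → ℝ)
    (hA : ∀ b : PBond (F.P K) 0, A b = (((F.L : ℝ) ^ (K - n)) ^ 3 * (F.L : ℝ) ^ (K - n))⁻¹ *
      (((((b.src b.dir).val % F.L ^ (K - n) : ℕ) : ℝ) + 1) * μc ⟨Site.proj (K - n) (K - n) b.src, b.dir⟩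
        + ((F.L ^ (K - n) - 1 - (b.src b.dir).val % F.L ^ (K - n) : ℕ) : ℝ) * μc ⟨(Site.proj (K - n) (K - n) b.src).unshift b.dir, b.dir⟩))
    {B : ℝ} (hB : ∀ b : PBond (F.P K) 0, |A b| ≤ B) (Y : VecField (F.P K) 0 ℝ) :
    |∑ b : PBond (F.P K) 0, A b * Y b| ≤ ((F.L : ℝ) ^ (K - n)) ^ 3 * B * ∑ c : PBond (F.P K) (K - n), |bondAvgIter (K - n) Y c| ∧
    ∀ c : PBond (F.P K) (K - n), |μc c| ≤ ((F.L : ℝ) ^ (K - n)) ^ 3 * B := by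
  have hk : K - n ≤ (F.P K).m + (F.P K).K := by show K - n ≤ F.m + K; omega
  have h := Prop7FlatCoercivity.sitesPerDir_zero_eq_pow_mul hk
  exact ⟨abs_sum_adjField_mul_le_bondAvgIter (P := F.P K) h μc A hA hk hB Y,
    fun c => abs_le_pow_mul_of_adjField_abs_le (P := F.P K) h μc A hA hB c⟩

end Summit.QuantumFields.YangMills.Theorems.Prop7LineAvgAdjoint

end
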